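import Literature.NumberTheory.Sieve.ThetaUnitExpansion
import HarnessLib

/-!
# `Θ_{Ω'}(χ)` regrouped by principal prime ideals

Topic `Literature/NumberTheory/Sieve`, sub-namespace `ThetaUnits` (continued). The smooth sum
`Θ_{Ω'}(χ) = ∑_{α ∈ A₀(M), α prime} Ω'(α)χ(α)` (`SmoothSmallModuli.theta`) is a sum over prime
ELEMENTS; grouping the `α` by the prime ideal `(α)` and writing the totally positive generators of
`𝔭 = (ω₀)` as `ηω₀`, `η ∈ U⁺` (Mitsui 1956 §3):

* `mem_cubeF_of_weightΩfam_ne_zero` — family version of the support lemma;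
* `fibre_sum_eq_tsum` — `∑_{α ∈ T, (α) = (ω₀)} Ω'(α)χ(α) = ∑'_{η ∈ U⁺} Ω'(ηω₀)χ(ηω₀)`
  (`T` = the prime elements of the cube);
* `gen 𝔭` — a chosen generator in `T` of `𝔭 ∈ P = T.image (·)`;
* **`theta_eq_sum_ideals`** — `Θ_{Ω'}(χ) = ∑_{𝔭 ∈ P} ∑'_{η ∈ U⁺} Ω'(η gen 𝔭) χ(η gen 𝔭)`, and with
  `ThetaUnitExpansion.tsum_posUnits_eq_sum_periodize`,
  **`theta_eq_sum_periodize`** — `Θ_{Ω'}(χ) = ∑_{𝔭 ∈ P} ∑_{q ∈ U⁺/U_𝔣} χ(r_q gen 𝔭) (periodize L_𝔣 Φ)(h)`.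

## References

* T. Mitsui, Jap. J. Math. 26 (1956), §3. [cite: Mitsui1956, §3]
* J. Hinz, Acta Arith. 51 (1988), §2. [cite: Hinz1988, §2]
-/

noncomputable section

open NumberField NumberField.InfinitePlace NumberField.Units NumberField.Units.dirichletUnitTheorem
  Literature.NumberTheory.LFunctions Literature.NumberTheory.LFunctions.HeckeCone
  Literature.NumberTheory.LFunctions.AbelianDensity
  Literature.NumberTheory.Sieve.UnitKernel Literature.NumberTheory.Sieve.UnitPeriodic
  Literature.Algebra.EuclideanLattices.LatticePeriodic Module
  Literature.NumberTheory.Sieve.NumberFieldLS Literature.NumberTheory.Sieve.SmoothTypeOne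
  Literature.NumberTheory.Sieve.BoxPrimes Literature.NumberTheory.Sieve.TypeTwoBlock
  Literature.NumberTheory.Sieve.TypeTwoReparam Literature.NumberTheory.Sieve.SmoothSmallModuli
open scoped Classical

namespace Literature.NumberTheory.Sieve.ThetaUnits

variable {K : Type*} [Field K] [NumberField K] [IsTotallyReal K]

local notation "RP" => {w : InfinitePlace K // IsReal w}

/-! ## Support of the family weight -/

/-- **Support**: if every profile vanishes on `(0, ∞)`, `α ≫ 0` and `Ω'(α) ≠ 0` then `α ∈ A₀(M)`.
[folklore] -/
theorem mem_cubeF_of_weightΩfam_ne_zero {kf : RP → ℝ → ℝ} (hhi : ∀ w v, 0 < v → kf w v = 0) {M : ℝ} (hM : 0 < M)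
    {α : 𝓞 K} (hα : NumberField.IsTotPos K (α : K)) (hne : weightΩfam K kf M α ≠ 0) : α ∈ cubeF K M := by
  rw [mem_cubeF, mem_box₀_iff_remb]
  intro w
  have hpos : 0 < remb K (α : K) w := remb_pos_of_isTotPos hα w
  refine ⟨hpos, ?_⟩
  by_contra hlt
  push Not at hlt
  apply hne
  unfold weightΩfam
  refine Finset.prod_eq_zero (Finset.mem_univ w) ?_
  rw [hhi w _ (by have := Real.log_lt_log hM hlt; linarith)]
  simp

/-! ## The fibre over a principal prime ideal -/

variable {𝔣 : Ideal (𝓞 K)} (χ : AddChar (Additive ((𝓞 K ⧸ 𝔣)ˣ)) ℂ)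

/-- The prime elements of the cube. [folklore] -/
abbrev Tset (M : ℝ) : Finset (𝓞 K) := (cubeF K M).filter Prime

/-- A unit quotient of two totally positive elements is totally positive. [folklore] -/
theorem mem_posUnits_of_mul_eq {u : (𝓞 K)ˣ} {ω₀ α : 𝓞 K} (hω₀ : NumberField.IsTotPos K (ω₀ : K))
    (hα : NumberField.IsTotPos K (α : K)) (h : (u : 𝓞 K) * ω₀ = α) : u ∈ posUnits K := by
  rw [mem_posUnits_iff]
  have hω0 : (ω₀ : K) ≠ 0 := fun h0 => by
    obtain ⟨w⟩ := (inferInstance : Nonempty (InfinitePlace K))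
    have := hω₀ ⟨w, IsTotallyReal.isReal w⟩
    rw [h0, map_zero] at this
    exact lt_irrefl _ this
  have hu : (((u : 𝓞 K) : K)) = (α : K) * (ω₀ : K)⁻¹ := by
    rw [eq_mul_inv_iff_mul_eq₀ hω0]; exact_mod_cast h
  rw [hu]
  exact hα.mul hω₀.inv

/-- **The fibre sum over `(ω₀)` is the unit sum**: for `ω₀ ∈ T`,
`∑_{α ∈ T, (α) = (ω₀)} Ω'(α)χ(α) = ∑'_{η ∈ U⁺} Ω'(ηω₀)χ(ηω₀)`. [cite: Mitsui1956, §3] -/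
theorem fibre_sum_eq_tsum {kf : RP → ℝ → ℝ} (hhi : ∀ w v, 0 < v → kf w v = 0) {M : ℝ} (hM : 0 < M)
    {ω₀ : 𝓞 K} (hω₀ : ω₀ ∈ Tset M) :
    ∑ α ∈ (Tset (K := K) M).filter (fun α => Ideal.span {α} = Ideal.span {ω₀}),
        weightΩfam K kf M α * unitValue χ (Ideal.Quotient.mk 𝔣 α) =
      ∑' η : posUnits K, Fsum χ kf M ω₀ η := by
  obtain ⟨hω₀c, hω₀p⟩ := Finset.mem_filter.1 hω₀
  have hω₀0 : ω₀ ≠ 0 := hω₀p.ne_zero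
  have hω₀pos := isTotPos_of_mem_cubeF hω₀c
  set F := (Tset (K := K) M).filter (fun α => Ideal.span {α} = Ideal.span {ω₀}) with hF
  set f : posUnits K → 𝓞 K := fun η => (((η : posUnits K) : (𝓞 K)ˣ) : 𝓞 K) * ω₀ with hf
  have hfinj : Function.Injective f := by
    intro η η' h
    have := mul_injective (K := K) hω₀0 (congrArg (fun x : 𝓞 K => (x : K)) h)
    exact this
  -- the unit sum is the finite sum over the preimage of `F`
  have hsupp : ∀ η : posUnits K, Fsum χ kf M ω₀ η ≠ 0 → f η ∈ F := by
    intro η hη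
    have hw : weightΩfam K kf M (f η) ≠ 0 := fun h0 => hη (by unfold Fsum; rw [show (((η : posUnits K) : (𝓞 K)ˣ) : 𝓞 K) * ω₀ = f η from rfl, h0, zero_mul])
    have hpos : NumberField.IsTotPos K ((f η : 𝓞 K) : K) := by
      simp only [hf]; push_cast
      exact (mem_posUnits_iff.1 η.2).mul hω₀pos
    have hcube := mem_cubeF_of_weightΩfam_ne_zero hhi hM hpos hw
    have hassoc : Associated ω₀ (f η) := ⟨((η : posUnits K) : (𝓞 K)ˣ), by simp only [hf]; rw [mul_comm]⟩
    refine Finset.mem_filter.2 ⟨Finset.mem_filter.2 ⟨hcube, hassoc.prime hω₀p⟩, ?_⟩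
    rw [Ideal.span_singleton_eq_span_singleton]
    exact hassoc.symm
  rw [tsum_eq_sum (s := F.preimage f hfinj.injOn) (fun η hη => by
    by_contra hne
    exact hη (Finset.mem_preimage.2 (hsupp η hne)))]
  -- `∑_{η ∈ f⁻¹ F} Fsum η = ∑_{α ∈ F} G α`
  have h := Finset.sum_preimage f F hfinj.injOn (fun α => weightΩfam K kf M α * unitValue χ (Ideal.Quotient.mk 𝔣 α)) ?_
  · rw [← h]
    rfl
  · -- every `α ∈ F` is in the range of `f`
    intro α hα hnot
    exfalso
    apply hnot
    obtain ⟨hαT, hspan⟩ := Finset.mem_filter.1 hα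
    obtain ⟨hαc, -⟩ := Finset.mem_filter.1 hαT
    obtain ⟨u, hu⟩ := Ideal.span_singleton_eq_span_singleton.1 hspan.symm
    -- `ω₀ * u = α`
    refine ⟨⟨u, mem_posUnits_of_mul_eq hω₀pos (isTotPos_of_mem_cubeF hαc) (by rw [mul_comm]; exact hu)⟩, ?_⟩
    simp only [hf]
    rw [mul_comm]; exact hu

/-! ## Regrouping `Θ` by ideals -/

/-- The principal prime ideals generated by the prime elements of the cube. [folklore] -/
abbrev Pset (M : ℝ) : Finset (Ideal (𝓞 K)) := (Tset (K := K) M).image fun α => Ideal.span {α}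

/-- A chosen generator in `T` of `𝔭 ∈ P` (junk `0` off `P`). [folklore] -/
def gen (M : ℝ) (𝔭 : Ideal (𝓞 K)) : 𝓞 K :=
  if h : ∃ α ∈ Tset (K := K) M, Ideal.span {α} = 𝔭 then h.choose else 0

omit [IsTotallyReal K] in
/-- The defining property of `gen`. [folklore] -/
theorem gen_spec {M : ℝ} {𝔭 : Ideal (𝓞 K)} (h𝔭 : 𝔭 ∈ Pset (K := K) M) :
    gen M 𝔭 ∈ Tset (K := K) M ∧ Ideal.span {gen M 𝔭} = 𝔭 := by
  obtain ⟨α, hα, rfl⟩ := Finset.mem_image.1 h𝔭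
  have h : ∃ β ∈ Tset (K := K) M, Ideal.span {β} = Ideal.span {α} := ⟨α, hα, rfl⟩
  rw [gen, dif_pos h]
  exact h.choose_spec

/-- **`Θ_{Ω'}(χ) = ∑_{𝔭 ∈ P} ∑'_{η ∈ U⁺} Ω'(η ω₀(𝔭)) χ(η ω₀(𝔭))`.** [cite: Mitsui1956, §3] -/
theorem theta_eq_sum_ideals {kf : RP → ℝ → ℝ} (hhi : ∀ w v, 0 < v → kf w v = 0) {M : ℝ} (hM : 0 < M) :
    theta K kf M χ = ∑ 𝔭 ∈ Pset (K := K) M, ∑' η : posUnits K, Fsum χ kf M (gen M 𝔭) η := by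
  unfold theta
  rw [← Finset.sum_fiberwise_of_maps_to (g := fun α : 𝓞 K => Ideal.span {α}) (t := Pset (K := K) M)
    (fun α hα => Finset.mem_image_of_mem _ hα)]
  refine Finset.sum_congr rfl fun 𝔭 h𝔭 => ?_
  obtain ⟨hgen, hspan⟩ := gen_spec h𝔭
  rw [← fibre_sum_eq_tsum χ hhi hM hgen]
  refine Finset.sum_congr ?_ fun _ _ => rfl
  ext α
  simp only [Finset.mem_filter, hspan]

/-- **`Θ_{Ω'}(χ)` as a finite sum of lattice periodizations**:
`Θ = ∑_{𝔭 ∈ P} ∑_{q ∈ U⁺/U_𝔣} χ(r_q ω₀(𝔭)) · periodize L_𝔣 (Φ_{t}) (h(r_q ω₀(𝔭)))`.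
[cite: Mitsui1956, §3] -/
theorem theta_eq_sum_periodize [Fintype (posUnits K ⧸ Hsub χ)] {kf : RP → ℝ → ℝ} (hhi : ∀ w v, 0 < v → kf w v = 0)
    {M : ℝ} (hM : 0 < M) :
    theta K kf M χ = ∑ 𝔭 ∈ Pset (K := K) M, ∑ q : posUnits K ⧸ Hsub χ,
      unitValue χ (Ideal.Quotient.mk 𝔣 ((((q.out : posUnits K) : (𝓞 K)ˣ) : 𝓞 K) * gen M 𝔭)) *
        (periodize (kerLattice χ)
          (PhiT K kf M (toTH K (logVec K (((((q.out : posUnits K) : (𝓞 K)ˣ) : 𝓞 K) * gen M 𝔭 : 𝓞 K) : K))).1)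
          (toTH K (logVec K (((((q.out : posUnits K) : (𝓞 K)ˣ) : 𝓞 K) * gen M 𝔭 : 𝓞 K) : K))).2 : ℂ) := by
  rw [theta_eq_sum_ideals χ hhi hM]
  refine Finset.sum_congr rfl fun 𝔭 h𝔭 => ?_
  have h0 : gen M 𝔭 ≠ 0 := (Finset.mem_filter.1 (gen_spec h𝔭).1).2.ne_zero
  exact tsum_posUnits_eq_sum_periodize χ hhi hM h0

end Literature.NumberTheory.Sieve.ThetaUnits
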